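import Summits.CriticalPhenomena.PercolationContinuityZ3.Theorems.Transplant.Bcc111SKBits
import Summits.CriticalPhenomena.PercolationContinuityZ3.Theorems.Transplant.Bcc111FilmLifts
import Summits.CriticalPhenomena.PercolationContinuityZ3.Theorems.Transplant.Slab111SKGeo
import HarnessLib

/-!
# The bcc (111)-films at small thickness, III: the bitboard INDICES AS FILM VERTICES of `F_m(bcc)`

builds on p205010 (kernel theorem, internal audit signed; external expert review pending) — NOT used in this file.  Lane `prim-bschramm`, seat
`prim-bschramm-p2` (gen 49; class C1b; memo `HOME/bschramm/P2-LATTICES.md` §160); helper file (`--supports stmt-CriticalPhenomena-4575 --as helper`).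
The dictionary between the kernel checker «Bcc111SKDefs» and the film `F_m(bcc)` («Bcc111FilmHexShadow», «Bcc111FilmLifts»): an index
`i = 100·L + 10·(a+5) + (b+5)` of a case context `C` (thickness `C.k = m`, class `C.c0 ≡ z₀ − z₁ (mod 3)`) is the film vertex
`ivtx m z i = Bcc111.vtx m (z + (a, b)) L` — the twin of «Slab111SKGeo» (same digit arithmetic; the bcc adjacency adds the elevator `L ↦ L + 3`).
* §1 validity ⇒ admissibility (`adm_of_valid`), shadow and level of `ivtx`, injectivity;
* §2 adjacency: `AdjRelE` of valid indices is a film edge (`adj_ivtx`) and conversely (`adjRelE_of_adj`, via `sh_lev_of_adj`: along a bond of `F_m(bcc)`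
  the level moves by `±1` with a unit shadow step, or by `±3` inside the column); every film vertex over `hexBall z 4` has an index (`exists_idx`);
* §3 reading the block / window / centre / column tests (`inRB_iff_mem_blkR`, `inWinB_of_inWin`, `inWin2B_of_inWin`, `cenB_iff`, `testBit_colM_iff_sh`, …).
[cite: DuminilCopinSidoraviciusTassion2016, §2.3 (proof of Fact 2: the ball B_R(z))] [cite: ConwaySloane1999, Ch. 4 §7.1]
-/

noncomputable section

namespace Summit.CriticalPhenomena.PercolationContinuityZ3.Theorems.Transplant

open Literature.Probability.Percolation Literature.Probability.LatticeModels SimpleGraph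
open scoped Classical

namespace Bcc111.SK

open Slab111 (lev)
open Slab111.SK (dL dA dB bitOf sdiff lowStep lowIdx maskOfList endsOK maskBelow orFold rd rdMask colSlots testBit_bitOf testBit_sdiff
  testBit_maskBelow of_testBit_maskBelow testBit_maskBelow_of testBit_foldl_or testBit_orFold testBit_maskOfList digits_eq mod_digits testBit_colSlots)

/-! ## §1 Validity, the vertex of an index -/

/-- Reading `validB`. [folklore] -/
theorem validB_iff (C : CtxE) (i : ℕ) : C.validB i = true ↔ i < 1000 ∧ 1 ≤ dA i ∧ dA i ≤ 9 ∧ 1 ≤ dB i ∧ dB i ≤ 9 ∧ 6 ≤ dA i + dB i ∧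
    dA i + dB i ≤ 14 ∧ dL i ≤ C.k ∧ dL i % 3 = (C.c0 + dA i + 2 * dB i) % 3 := by
  simp only [CtxE.validB, Bool.and_eq_true, decide_eq_true_eq, beq_iff_eq, and_assoc]

/-- **The class hypothesis on the block centre**: `z₀ + 2 z₁ ≡ c₀ (mod 3)` (equivalently `z₀ − z₁ ≡ c₀`: the base level of the centre column). [folklore] -/
def ClassHyp (C : CtxE) (z : Site 2) : Prop := (3 : ℤ) ∣ z 0 + 2 * z 1 - (C.c0 : ℤ)

/-- The column of an index: `z + (a, b)`. [folklore] -/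
def relP (z : Site 2) (i : ℕ) : Site 2 := ![z 0 + ((dA i : ℤ) - 5), z 1 + ((dB i : ℤ) - 5)]

/-- **The film vertex of an index.** [folklore] -/
def ivtx (m : ℕ) (z : Site 2) (i : ℕ) : bfilm m := Bcc111.vtx m (relP z i) (dL i)

variable {C : CtxE} {z : Site 2}

/-- A valid index is an admissible (column, level) pair of the film. [folklore] -/
theorem adm_of_valid (hz : ClassHyp C z) {i : ℕ} (hv : C.validB i = true) : Adm C.k (relP z i) (dL i) := by
  rw [validB_iff] at hv
  obtain ⟨-, -, -, -, -, -, -, hk, hmod⟩ := hv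
  unfold ClassHyp at hz
  refine ⟨by omega, by exact_mod_cast hk, ?_⟩
  simp only [relP, Matrix.cons_val_zero, Matrix.cons_val_one]
  omega

/-- The shadow of the vertex of a valid index. [folklore] -/
theorem sh_ivtx (hz : ClassHyp C z) {i : ℕ} (hv : C.validB i = true) : sh (ivtx C.k z i) = relP z i := by
  rw [ivtx, Bcc111.sh_vtx (adm_of_valid hz hv)]

/-- Coordinates of the shadow. [folklore] -/
theorem sh_ivtx_zero (hz : ClassHyp C z) {i : ℕ} (hv : C.validB i = true) : sh (ivtx C.k z i) 0 = z 0 + ((dA i : ℤ) - 5) := by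
  rw [sh_ivtx hz hv]; rfl

/-- Coordinates of the shadow. [folklore] -/
theorem sh_ivtx_one (hz : ClassHyp C z) {i : ℕ} (hv : C.validB i = true) : sh (ivtx C.k z i) 1 = z 1 + ((dB i : ℤ) - 5) := by
  rw [sh_ivtx hz hv]; rfl

/-- The level of the vertex of a valid index. [folklore] -/
theorem lev_ivtx (hz : ClassHyp C z) {i : ℕ} (hv : C.validB i = true) : lev (pt (ivtx C.k z i)) = dL i := by
  rw [ivtx, Bcc111.lev_vtx (adm_of_valid hz hv)]

/-- **`ivtx` is injective on valid indices.** [folklore] -/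
theorem ivtx_inj (hz : ClassHyp C z) {i j : ℕ} (hi : C.validB i = true) (hj : C.validB j = true) (h : ivtx C.k z i = ivtx C.k z j) : i = j := by
  have h0 : sh (ivtx C.k z i) 0 = sh (ivtx C.k z j) 0 := by rw [h]
  have h1 : sh (ivtx C.k z i) 1 = sh (ivtx C.k z j) 1 := by rw [h]
  have h2 : lev (pt (ivtx C.k z i)) = lev (pt (ivtx C.k z j)) := by rw [h]
  rw [sh_ivtx_zero hz hi, sh_ivtx_zero hz hj] at h0
  rw [sh_ivtx_one hz hi, sh_ivtx_one hz hj] at h1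
  rw [lev_ivtx hz hi, lev_ivtx hz hj] at h2
  rw [digits_eq i, digits_eq j]; omega

/-! ## §2 Adjacency and indexing of film vertices -/

/-- Column digit ranges of a valid index. [folklore] -/
theorem ranges_of_valid {C : CtxE} {i : ℕ} (hv : C.validB i = true) : 1 ≤ dA i ∧ dA i ≤ 9 ∧ 1 ≤ dB i ∧ dB i ≤ 9 := by
  have h := (validB_iff C i).1 hv
  exact ⟨h.2.1, h.2.2.1, h.2.2.2.1, h.2.2.2.2.1⟩

/-- One forward step in digits: a planar up-step (level `+1`, shadow `+u`, `u ∈ U`) or the elevator (level `+3`, same column). [folklore] -/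
def FwdStep (i j : ℕ) : Prop :=
  (dL j = dL i + 1 ∧ ((dA j = dA i + 1 ∧ dB j = dB i) ∨ (dA j = dA i ∧ dB j + 1 = dB i) ∨ (dA j + 1 = dA i ∧ dB j = dB i + 1))) ∨
    (dL j = dL i + 3 ∧ dA j = dA i ∧ dB j = dB i)

/-- `AdjRelE` of indices with column digits in `[1, 9]` is a forward step one way or the other. [folklore] -/
theorem fwdStep_of_adjRelE {i j : ℕ} (hi : 1 ≤ dA i ∧ dA i ≤ 9 ∧ 1 ≤ dB i ∧ dB i ≤ 9) (hj : 1 ≤ dA j ∧ dA j ≤ 9 ∧ 1 ≤ dB j ∧ dB j ≤ 9)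
    (h : AdjRelE i j) : FwdStep i j ∨ FwdStep j i := by
  have ei := digits_eq i; have ej := digits_eq j
  have mi := mod_digits i; have mj := mod_digits j
  unfold FwdStep
  rcases h with h | h | h | h | h | h | h | h
  · exact Or.inl (Or.inl ⟨by omega, Or.inl ⟨by omega, by omega⟩⟩)
  · exact Or.inl (Or.inl ⟨by omega, Or.inr (Or.inl ⟨by omega, by omega⟩)⟩)
  · exact Or.inl (Or.inl ⟨by omega, Or.inr (Or.inr ⟨by omega, by omega⟩)⟩)
  · exact Or.inl (Or.inr ⟨by omega, by omega, by omega⟩)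
  · exact Or.inr (Or.inl ⟨by omega, Or.inl ⟨by omega, by omega⟩⟩)
  · exact Or.inr (Or.inl ⟨by omega, Or.inr (Or.inl ⟨by omega, by omega⟩)⟩)
  · exact Or.inr (Or.inl ⟨by omega, Or.inr (Or.inr ⟨by omega, by omega⟩)⟩)
  · exact Or.inr (Or.inr ⟨by omega, by omega, by omega⟩)

/-- **A forward step of valid indices is a film edge.** [cite: ConwaySloane1999, Ch. 4 §7.1] -/
theorem adj_of_fwdStep (hz : ClassHyp C z) {i j : ℕ} (hi : C.validB i = true) (hj : C.validB j = true) (h : FwdStep i j) :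
    (film C.k).Adj (ivtx C.k z i) (ivtx C.k z j) := by
  have hai := adm_of_valid hz hi
  have haj := adm_of_valid hz hj
  have hkj := ((validB_iff C j).1 hj).2.2.2.2.2.2.2.1
  rcases h with ⟨hl, hs⟩ | ⟨hl, ha, hb⟩
  · -- planar up-step
    obtain ⟨u, hu, hP⟩ : ∃ u : Site 2, IsUp u ∧ relP z j = relP z i + u := by
      rcases hs with ⟨h1, h2⟩ | ⟨h1, h2⟩ | ⟨h1, h2⟩
      · refine ⟨![1, 0], Or.inl rfl, ?_⟩; ext t; fin_cases t <;> simp [relP, h1, h2]; all_goals omega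
      · refine ⟨![0, -1], Or.inr (Or.inr rfl), ?_⟩; ext t; fin_cases t <;> simp [relP, h1]; all_goals omega
      · refine ⟨![-1, 1], Or.inr (Or.inl rfl), ?_⟩; ext t; fin_cases t <;> simp [relP, h2]; all_goals omega
    have hk1 : dL i + 1 ≤ C.k := by rw [← hl]; exact hkj
    have hstep := Bcc111.adj_vtx_up hai hu (by exact_mod_cast hk1)
    rw [ivtx, ivtx, hP, hl]; push_cast; exact hstep
  · -- elevator
    have hP : relP z j = relP z i := by ext t; fin_cases t <;> simp [relP, ha, hb]
    have hk1 : dL i + 3 ≤ C.k := by rw [← hl]; exact hkj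
    have hstep := Bcc111.adj_vtx_elev hai (by exact_mod_cast hk1)
    rw [ivtx, ivtx, hP, hl]; push_cast; exact hstep

/-- **Adjacent valid indices are adjacent film vertices.** [folklore] -/
theorem adj_ivtx (hz : ClassHyp C z) {i j : ℕ} (hi : C.validB i = true) (hj : C.validB j = true) (h : AdjRelE i j) :
    (film C.k).Adj (ivtx C.k z i) (ivtx C.k z j) := by
  rcases fwdStep_of_adjRelE (ranges_of_valid hi) (ranges_of_valid hj) h with hs | hs
  · exact adj_of_fwdStep hz hi hj hs
  · exact (adj_of_fwdStep hz hj hi hs).symm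

/-- **The shadow/level change along a bond of `F_m(bcc)`**: one level up along an up-direction, or the reverse, or three levels inside the column
(the elevator), or the reverse. [cite: ConwaySloane1999, Ch. 4 §7.1] -/
theorem sh_lev_of_adj {m : ℕ} {x y : bfilm m} (h : (film m).Adj x y) :
    (lev (pt y) = lev (pt x) + 1 ∧
        ((sh y 0 = sh x 0 + 1 ∧ sh y 1 = sh x 1) ∨ (sh y 0 = sh x 0 ∧ sh y 1 = sh x 1 - 1) ∨ (sh y 0 = sh x 0 - 1 ∧ sh y 1 = sh x 1 + 1))) ∨
      (lev (pt x) = lev (pt y) + 1 ∧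
        ((sh x 0 = sh y 0 + 1 ∧ sh x 1 = sh y 1) ∨ (sh x 0 = sh y 0 ∧ sh x 1 = sh y 1 - 1) ∨ (sh x 0 = sh y 0 - 1 ∧ sh x 1 = sh y 1 + 1))) ∨
      (lev (pt y) = lev (pt x) + 3 ∧ sh y 0 = sh x 0 ∧ sh y 1 = sh x 1) ∨ (lev (pt x) = lev (pt y) + 3 ∧ sh y 0 = sh x 0 ∧ sh y 1 = sh x 1) := by
  have h' : bccGraph.Adj (x : bccSite) (y : bccSite) := h
  have f0 : |pt x 0 - pt y 0| = 1 := bcc_abs_sub_eq_one h' 0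
  have f1 : |pt x 1 - pt y 1| = 1 := bcc_abs_sub_eq_one h' 1
  have f2 : |pt x 2 - pt y 2| = 1 := bcc_abs_sub_eq_one h' 2
  have e0 := abs_le.1 f0.le
  have e1 := abs_le.1 f1.le
  have e2 := abs_le.1 f2.le
  have n0 : pt x 0 - pt y 0 ≠ 0 := fun h0 => by rw [h0, abs_zero] at f0; exact zero_ne_one f0
  have n1 : pt x 1 - pt y 1 ≠ 0 := fun h1 => by rw [h1, abs_zero] at f1; exact zero_ne_one f1
  have n2 : pt x 2 - pt y 2 ≠ 0 := fun h2 => by rw [h2, abs_zero] at f2; exact zero_ne_one f2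
  have a0 := two_mul_sh_zero x; have a1 := two_mul_sh_one x
  have b0 := two_mul_sh_zero y; have b1 := two_mul_sh_one y
  simp only [lev]
  omega

/-- **Adjacent vertices of valid indices have adjacent indices.** [folklore] -/
theorem adjRelE_of_adj (hz : ClassHyp C z) {i j : ℕ} (hi : C.validB i = true) (hj : C.validB j = true)
    (h : (film C.k).Adj (ivtx C.k z i) (ivtx C.k z j)) : AdjRelE i j := by
  have H := sh_lev_of_adj h
  rw [lev_ivtx hz hi, lev_ivtx hz hj, sh_ivtx_zero hz hi, sh_ivtx_zero hz hj, sh_ivtx_one hz hi, sh_ivtx_one hz hj] at H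
  have ei := digits_eq i; have ej := digits_eq j
  have mi := mod_digits i; have mj := mod_digits j
  unfold AdjRelE
  omega

/-- **Every film vertex over `hexBall z 4` has a valid index** (`m ≤ 9`). [folklore] -/
theorem exists_idx (hz : ClassHyp C z) (hk : C.k ≤ 9) (x : bfilm C.k) (hx : triNorm (sh x - z) ≤ 4) :
    ∃ i, C.validB i = true ∧ ivtx C.k z i = x := by
  have hadm := Bcc111.adm_sh_lev x
  obtain ⟨h0, hm, ⟨c, hc⟩⟩ := hadm
  simp only [triNorm, Pi.sub_apply, max_le_iff, abs_le] at hx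
  obtain ⟨⟨ha1, ha2⟩, ⟨hb1, hb2⟩, hab1, hab2⟩ := hx
  obtain ⟨L, hL⟩ := Int.eq_ofNat_of_zero_le h0
  obtain ⟨A, hA⟩ := Int.eq_ofNat_of_zero_le (show (0 : ℤ) ≤ sh x 0 - z 0 + 5 by omega)
  obtain ⟨B, hB⟩ := Int.eq_ofNat_of_zero_le (show (0 : ℤ) ≤ sh x 1 - z 1 + 5 by omega)
  unfold ClassHyp at hz
  have hdL : dL (100 * L + 10 * A + B) = L := by unfold dL; omega
  have hdA : dA (100 * L + 10 * A + B) = A := by unfold dA; omega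
  have hdB : dB (100 * L + 10 * A + B) = B := by unfold dB; omega
  refine ⟨100 * L + 10 * A + B, ?_, ?_⟩
  · rw [validB_iff, hdL, hdA, hdB]
    refine ⟨by omega, by omega, by omega, by omega, by omega, by omega, by omega, by omega, ?_⟩
    omega
  · have hq : relP z (100 * L + 10 * A + B) = sh x := by
      ext t; fin_cases t
      · show z 0 + ((dA (100 * L + 10 * A + B) : ℤ) - 5) = sh x 0
        rw [hdA]; omega
      · show z 1 + ((dB (100 * L + 10 * A + B) : ℤ) - 5) = sh x 1
        rw [hdB]; omega
    have hl : ((dL (100 * L + 10 * A + B) : ℕ) : ℤ) = lev (pt x) := by rw [hdL]; omega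
    rw [ivtx, hq, hl, Bcc111.vtx_sh_lev]

/-- A bond keeps the shadow within one more ring. [folklore] -/
theorem triNorm_le_succ_of_adj {m : ℕ} {x y : bfilm m} {z : Site 2} {n : ℤ} (hx : triNorm (sh x - z) ≤ n) (h : (film m).Adj x y) :
    triNorm (sh y - z) ≤ n + 1 := by
  have H := sh_lev_of_adj h
  simp only [triNorm, Pi.sub_apply, max_le_iff, abs_le] at hx ⊢
  omega

/-- **A neighbour of the vertex of a rerouting-block index has a valid index, adjacent in `AdjRelE`.** [folklore] -/
theorem exists_idx_of_adj (hz : ClassHyp C z) (hk : C.k ≤ 9) {i : ℕ} (hi : C.validB i = true) (h3 : triNorm (sh (ivtx C.k z i) - z) ≤ 3)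
    {y : bfilm C.k} (h : (film C.k).Adj (ivtx C.k z i) y) : ∃ j, C.validB j = true ∧ ivtx C.k z j = y ∧ AdjRelE i j := by
  obtain ⟨j, hj, rfl⟩ := exists_idx hz hk y (by have := triNorm_le_succ_of_adj h3 h; omega)
  exact ⟨j, hj, rfl, adjRelE_of_adj hz hi hj h⟩

/-! ## §3 Reading the block, window, centre and column tests -/

/-- The shadow of a valid index relative to the centre, in digits. [folklore] -/
theorem triNorm_ivtx_le_iff (hz : ClassHyp C z) {i : ℕ} (hv : C.validB i = true) (n : ℕ) :
    triNorm (sh (ivtx C.k z i) - z) ≤ n ↔ dA i ≤ n + 5 ∧ 5 ≤ dA i + n ∧ dB i ≤ n + 5 ∧ 5 ≤ dB i + n ∧ dA i + dB i ≤ n + 10 ∧ 10 ≤ dA i + dB i + n := by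
  rw [sh_ivtx hz hv]
  simp only [relP, triNorm, Pi.sub_apply, Matrix.cons_val_zero, Matrix.cons_val_one, max_le_iff, abs_le]
  omega

/-- **The rerouting-block test reads membership in `blkR 3 z tR sR`.** [folklore] -/
theorem inRB_iff_mem_blkR (hz : ClassHyp C z) {i : ℕ} (hv : C.validB i = true) {tR sR : ℕ} (htR : C.tR = min tR 3) (hsR : C.sR = min sR 3) :
    C.inRB i = true ↔ sh (ivtx C.k z i) ∈ blkR 3 z tR sR := by
  rw [mem_blkR, mem_hexBall, show ((3 : ℕ) : ℤ) = ((3 : ℕ) : ℤ) from rfl, triNorm_ivtx_le_iff hz hv 3, sh_ivtx_zero hz hv, sh_ivtx_one hz hv]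
  simp only [CtxE.inRB, hv, Bool.true_and, Bool.and_eq_true, decide_eq_true_eq, htR, hsR]
  omega

/-- Membership in the cleared block `blkR 3 z tD sD` from the digit test used for the allowed mask. [folklore] -/
theorem mem_blkR_of_digits (hz : ClassHyp C z) {i : ℕ} (hv : C.validB i = true) {tD sD t1 s1 : ℕ} (ht : t1 ≤ tD) (hs : s1 ≤ sD)
    (h : 2 ≤ dA i ∧ dA i ≤ 8 ∧ 2 ≤ dB i ∧ dB i ≤ 8 ∧ 7 ≤ dA i + dB i ∧ dA i + dB i ≤ 13 ∧ dA i ≤ t1 + 5 ∧ dA i + dB i ≤ s1 + 10) :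
    sh (ivtx C.k z i) ∈ blkR 3 z tD sD := by
  rw [mem_blkR, mem_hexBall, show ((3 : ℕ) : ℤ) = ((3 : ℕ) : ℤ) from rfl, triNorm_ivtx_le_iff hz hv 3, sh_ivtx_zero hz hv, sh_ivtx_one hz hv]
  omega

/-- Reading membership in `hexBall z 1 ∩ blkR 3 z tD sD` into digits (for the forced mask). [folklore] -/
theorem digits_of_mem_hexBall_one (hz : ClassHyp C z) {i : ℕ} (hv : C.validB i = true) {tD sD : ℕ} (h1 : sh (ivtx C.k z i) ∈ hexBall z 1)
    (hD : sh (ivtx C.k z i) ∈ blkR 3 z tD sD) :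
    4 ≤ dA i ∧ dA i ≤ 6 ∧ 4 ≤ dB i ∧ dB i ≤ 6 ∧ 9 ≤ dA i + dB i ∧ dA i + dB i ≤ 11 ∧ dA i ≤ tD + 5 ∧ dA i + dB i ≤ sD + 10 := by
  rw [mem_hexBall, show ((1 : ℕ) : ℤ) = ((1 : ℕ) : ℤ) from rfl, triNorm_ivtx_le_iff hz hv 1] at h1
  rw [mem_blkR, sh_ivtx_zero hz hv, sh_ivtx_one hz hv] at hD
  omega

/-- **The `Terminals` window test from the real window** (case bounds at least the node's, or unconstrained). [folklore] -/
theorem inWinB_of_inWin (hz : ClassHyp C z) {i : ℕ} (hv : C.validB i = true) {tD sR : ℕ} (hwT : tD ≤ C.wT ∨ 4 ≤ C.wT) (hwS : sR ≤ C.wS ∨ 4 ≤ C.wS)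
    (h : HexShadow.InWin z tD sR (sh (ivtx C.k z i))) : C.inWinB i = true := by
  unfold HexShadow.InWin at h
  rw [sh_ivtx_zero hz hv, sh_ivtx_one hz hv] at h
  have hv' := (validB_iff C i).1 hv
  simp only [CtxE.inWinB, hv, Bool.true_and, Bool.and_eq_true, decide_eq_true_eq]
  omega

/-- **The exit window test from the real cleared window.** [folklore] -/
theorem inWin2B_of_inWin (hz : ClassHyp C z) {i : ℕ} (hv : C.validB i = true) {tD sD : ℕ} (hwT : tD ≤ C.wT ∨ 4 ≤ C.wT) (hwSD : sD ≤ C.wSD ∨ 4 ≤ C.wSD)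
    (h : HexShadow.InWin z tD sD (sh (ivtx C.k z i))) : C.inWin2B i = true := by
  unfold HexShadow.InWin at h
  rw [sh_ivtx_zero hz hv, sh_ivtx_one hz hv] at h
  have hv' := (validB_iff C i).1 hv
  simp only [CtxE.inWin2B, hv, Bool.true_and, Bool.and_eq_true, decide_eq_true_eq]
  omega

/-- **The centre test reads "over `z`".** [folklore] -/
theorem cenB_iff (hz : ClassHyp C z) {i : ℕ} (hv : C.validB i = true) : C.cenB i = true ↔ sh (ivtx C.k z i) = z := by
  simp only [CtxE.cenB, hv, Bool.true_and, Bool.and_eq_true, beq_iff_eq]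
  rw [sh_ivtx hz hv]
  constructor
  · rintro ⟨ha, hb⟩; ext t; fin_cases t <;> simp [relP, ha, hb]
  · intro h
    have h0 := congrFun h 0; have h1 := congrFun h 1
    simp [relP] at h0 h1; omega

/-- Two valid indices lie over the same column iff their column codes agree. [folklore] -/
theorem sh_eq_iff_mod (hz : ClassHyp C z) {i j : ℕ} (hi : C.validB i = true) (hj : C.validB j = true) :
    sh (ivtx C.k z i) = sh (ivtx C.k z j) ↔ i % 100 = j % 100 := by
  rw [sh_ivtx hz hi, sh_ivtx hz hj]
  have ei := digits_eq i; have ej := digits_eq j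
  have hi' := (validB_iff C i).1 hi; have hj' := (validB_iff C j).1 hj
  have mi := mod_digits i; have mj := mod_digits j
  constructor
  · intro h
    have h0 := congrFun h 0; have h1 := congrFun h 1
    simp [relP] at h0 h1
    omega
  · intro h
    have hA : dA i = dA j := by omega
    have hB : dB i = dB j := by omega
    simp only [relP, hA, hB]

/-- **Bits of a column mask**: the valid indices with the same column code. [folklore] -/
theorem testBit_colM_iff (C : CtxE) (e i : ℕ) : (C.colM e).testBit i = true ↔ C.validB i = true ∧ i % 100 = e % 100 := by
  unfold CtxE.colM
  rw [Nat.testBit_land, Bool.and_eq_true, Nat.testBit_shiftLeft, Bool.and_eq_true, decide_eq_true_eq, testBit_colSlots, CtxE.univ,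
    testBit_maskBelow, Bool.and_eq_true, decide_eq_true_eq]
  constructor
  · rintro ⟨⟨hle, L, hL, hn⟩, hi, hv⟩
    exact ⟨hv, by omega⟩
  · rintro ⟨hv, hmod⟩
    have hi := ((validB_iff C i).1 hv).1
    refine ⟨⟨by omega, i / 100, by omega, by omega⟩, hi, hv⟩

/-- Column mask membership reads equality of shadows. [folklore] -/
theorem testBit_colM_iff_sh (hz : ClassHyp C z) {e i : ℕ} (he : C.validB e = true) (hi : C.validB i = true) :
    (C.colM e).testBit i = true ↔ sh (ivtx C.k z i) = sh (ivtx C.k z e) := by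
  rw [testBit_colM_iff, sh_eq_iff_mod hz hi he]
  exact ⟨fun h => h.2, fun h => ⟨hi, h⟩⟩

/-- Universe bits are the valid indices. [folklore] -/
theorem testBit_univ_iff (C : CtxE) (i : ℕ) : C.univ.testBit i = true ↔ C.validB i = true := by
  rw [CtxE.univ, testBit_maskBelow, Bool.and_eq_true, decide_eq_true_eq]
  exact ⟨fun h => h.2, fun h => ⟨((validB_iff C i).1 h).1, h⟩⟩

/-- `inRB` implies validity. [folklore] -/
theorem validB_of_inRB {C : CtxE} {i : ℕ} (h : C.inRB i = true) : C.validB i = true := by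
  simp only [CtxE.inRB, Bool.and_eq_true] at h; exact h.1.1.1.1.1.1.1.1

/-- Rerouting-mask bits. [folklore] -/
theorem testBit_WR_iff (C : CtxE) (i : ℕ) : C.WR.testBit i = true ↔ C.W.testBit i = true ∧ C.inRB i = true := by
  rw [CtxE.WR, Nat.testBit_land, Bool.and_eq_true, testBit_maskBelow, Bool.and_eq_true, decide_eq_true_eq]
  constructor
  · rintro ⟨hW, -, hR⟩; exact ⟨hW, hR⟩
  · rintro ⟨hW, hR⟩
    exact ⟨hW, ((validB_iff C i).1 (validB_of_inRB hR)).1, hR⟩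

/-- `Terminals` window-mask bits. [folklore] -/
theorem testBit_win_iff (C : CtxE) (i : ℕ) : C.win.testBit i = true ↔ C.inWinB i = true := by
  rw [CtxE.win, testBit_maskBelow, Bool.and_eq_true, decide_eq_true_eq]
  constructor
  · rintro ⟨-, h⟩; exact h
  · intro h
    have hv : C.validB i = true := by simp only [CtxE.inWinB, Bool.and_eq_true] at h; exact h.1.1
    exact ⟨((validB_iff C i).1 hv).1, h⟩

/-- Exit window-mask bits. [folklore] -/
theorem testBit_win2_iff (C : CtxE) (i : ℕ) : C.win2.testBit i = true ↔ C.inWin2B i = true := by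
  rw [CtxE.win2, testBit_maskBelow, Bool.and_eq_true, decide_eq_true_eq]
  constructor
  · rintro ⟨-, h⟩; exact h
  · intro h
    have hv : C.validB i = true := by simp only [CtxE.inWin2B, Bool.and_eq_true] at h; exact h.1.1
    exact ⟨((validB_iff C i).1 hv).1, h⟩

/-- Centre-mask bits. [folklore] -/
theorem testBit_cen_iff (C : CtxE) (i : ℕ) : C.cen.testBit i = true ↔ C.cenB i = true := by
  rw [CtxE.cen, testBit_maskBelow, Bool.and_eq_true, decide_eq_true_eq]
  constructor
  · rintro ⟨-, h⟩; exact h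
  · intro h
    have hv : C.validB i = true := by simp only [CtxE.cenB, Bool.and_eq_true] at h; exact h.1.1
    exact ⟨((validB_iff C i).1 hv).1, h⟩

/-- `inRB` implies the radius-`3` digit bounds. [folklore] -/
theorem triNorm_le_three_of_inRB (hz : ClassHyp C z) {i : ℕ} (h : C.inRB i = true) : triNorm (sh (ivtx C.k z i) - z) ≤ 3 := by
  have hv := validB_of_inRB h
  rw [show (3 : ℤ) = ((3 : ℕ) : ℤ) from rfl, triNorm_ivtx_le_iff hz hv 3]
  simp only [CtxE.inRB, Bool.and_eq_true, decide_eq_true_eq] at h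
  omega

end Bcc111.SK

end Summit.CriticalPhenomena.PercolationContinuityZ3.Theorems.Transplant

end
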